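import Summits.QuantumFields.YangMills.Theorems.IR.TensionRatioWindowRP
import Summits.QuantumFields.YangMills.Theorems.IR.StrongCouplingRateColdPressure
import HarnessLib

/-!
# Crux `IR` (stmt-QuantumFields-19354), line `tension-ratio`: the `(0, β_D]`-UNIFORM ratio rung T2-sc-RP PROVED —
`ratioStrongCouplingRP_holds : RatioStrongCouplingRP`

Helper module for item `stmt-QuantumFields-19354` (`--supports … --as helper`; it closes nothing).  `RatioStrongCouplingRP` (tree constant,
`Theorems/IR/TensionRatioDefs.lean` §5) is the quantifier shape of the registered rung `stub_rung_ratioStrongCoupling : RatioStrongCoupling`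
(T2-sc: ONE ratio constant `c` for ALL `β ∈ (0, β_D]`) on the hypothesis vocabulary of the landed window rung `RatioStrongCouplingWindowRP`
(special-unitary fundamental model, area law read on even tori, p595411) — the window rung let `c = c(β₁) → 0` as the window `[β₁, β_D]` grows,
because the tree's strong-coupling cold pressure had the β-independent rate `1/8` while the admissible area-law rates reach `s ≍ log(1/β)`.

**Proof.**  (i) Rate cap at the SAME `β`: the plaquette floor `⟨W_{1×1}⟩_L ≥ c_pl β` (`exists_plaquette_ge_linear`, all tori of side `≥ 3`,
`0 < β ≤ β₂`) and the torus Seiler/Bachas RP bound `⟨W_{1×1}⟩^{n²} ≤ ⟨W_{n×n}⟩` on the even torus `2n` (p592927) turn an area law `(C, s)` on all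
large even tori into `s ≤ −log(w β)`, `w = min c_pl 1` (`rate_le_neg_log_of_areaLaw`).  (ii) Input (a), the RATE-TRACKING strong-coupling cold
pressure bound `StrongCouplingRate.coldPressureBound_strongCoupling_log` (p600923): `ColdPressureBound r.ρ β S (τ/8) C₀` on EVERY torus with
`τ = 1 + log(r_ρ/β)`, `r_ρ = strongCouplingRadius r.ρ`.  (iii) Arithmetic (`sqrt_rate_le_of_log`): `−log(wβ) = τ + κ₀` with the β-INDEPENDENT
`κ₀ = −log(w r_ρ) − 1`, so `−log(wβ) ≤ A·τ` with `A = 1 + max κ₀ 0`, and `c√s ≤ c√(Aτ) ≤ c√A·τ = τ/8` for `c = 1/(8√A)` (`τ ≥ 1`).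
`βD = min β₂ r_ρ`.  Then `coldPressureBound_mono_rate`.

HONEST FRAMING: a FORMAT rung inside the known strong-coupling regime (it exercises T2's interfaces with the `(0, β_D]`-uniform constant the
registered T2-sc asks for, on the RP/even-tori hypothesis vocabulary); the registered `RatioStrongCoupling` itself (general centre-charged `π`,
odd tori) still needs a volume-uniform LOWER bound on `|⟨χ_π(W_{R×T})⟩|` on odd tori (no RP input in the tree there); not consumed by
`IR_of`; `TensionFloor`/`RatioFloorSC` stay OPEN; the YM mass gap (Clay) is NOT proved; `R4` closes only the conditional rung `BalabanLadder.UV`.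
-/

set_option autoImplicit false

noncomputable section

open MeasureTheory Filter Topology
open Literature.MathematicalPhysics Literature.MathematicalPhysics.QuantumFieldTheory
open Literature.MathematicalPhysics.QuantumFieldTheory.Balaban1983to89.Sufficient (ColdPressureBound)
open Literature.MathematicalPhysics.QuantumFieldTheory.Balaban1983to89.Missing (strongCouplingRadius strongCouplingRadius_pos)
open Summit.QuantumFields.YangMills.Cruxes.IR.ColdPressurePincer
open Summit.QuantumFields.YangMills.Cruxes.IR.StrongCouplingRate (coldPressureBound_strongCoupling_log)

namespace Summit.QuantumFields.YangMills.Cruxes.IR.TensionRatio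

/-! ## §1 Arithmetic of the uniform constant (no gauge theory) -/

/-- **`√τ ≤ τ` for `τ ≥ 1`.** -/
theorem sqrt_le_self_of_one_le {τ : ℝ} (hτ : 1 ≤ τ) : Real.sqrt τ ≤ τ := by
  have hτ0 : 0 ≤ τ := le_trans zero_le_one hτ
  calc Real.sqrt τ ≤ Real.sqrt (τ ^ 2) := Real.sqrt_le_sqrt (by nlinarith)
    _ = τ := Real.sqrt_sq hτ0

/-- **The uniform ratio constant.**  If `ℓ = τ + κ₀`, `τ ≥ 1`, `A = 1 + max κ₀ 0` and `s ≤ ℓ`, then `(1/(8√A))·√s ≤ τ/8`. -/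
theorem sqrt_rate_le_of_log {s ℓ τ κ₀ : ℝ} (hτ : 1 ≤ τ) (hℓ : ℓ = τ + κ₀) (hsl : s ≤ ℓ) :
    1 / (8 * Real.sqrt (1 + max κ₀ 0)) * Real.sqrt s ≤ τ / 8 := by
  set A : ℝ := 1 + max κ₀ 0 with hA
  have hm0 : 0 ≤ max κ₀ 0 := le_max_right _ _
  have hA1 : 1 ≤ A := by rw [hA]; linarith
  have hA0 : 0 < A := lt_of_lt_of_le one_pos hA1
  have hsA : 0 < Real.sqrt A := Real.sqrt_pos.2 hA0
  have hτ0 : 0 ≤ τ := le_trans zero_le_one hτ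
  -- `s ≤ ℓ ≤ A τ`
  have hℓA : ℓ ≤ A * τ := by
    rw [hℓ, hA]
    have h1 : κ₀ ≤ max κ₀ 0 := le_max_left _ _
    nlinarith
  have hsq : Real.sqrt s ≤ Real.sqrt A * τ :=
    calc Real.sqrt s ≤ Real.sqrt (A * τ) := Real.sqrt_le_sqrt (hsl.trans hℓA)
      _ = Real.sqrt A * Real.sqrt τ := Real.sqrt_mul hA0.le τ
      _ ≤ Real.sqrt A * τ := mul_le_mul_of_nonneg_left (sqrt_le_self_of_one_le hτ) hsA.le
  calc 1 / (8 * Real.sqrt A) * Real.sqrt s ≤ 1 / (8 * Real.sqrt A) * (Real.sqrt A * τ) :=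
        mul_le_mul_of_nonneg_left hsq (by positivity)
    _ = τ / 8 := by field_simp

/-! ## §2 The `(0, β_D]`-uniform rung -/

/-- **Rung T2-sc-RP PROVED — ONE ratio constant on all of `(0, β_D]`.**  For the special-unitary fundamental model (`N ≥ 2`) of a
simply-connected compact simple `G`: with `w = min c_pl 1`, `r_ρ = strongCouplingRadius r.ρ`, `κ₀ = −log(w r_ρ) − 1`, the constant
`c = 1/(8√(1 + max κ₀ 0))` and `βD = min β₂ r_ρ` serve every `β ∈ (0, βD]`: an area law `(C, s)` for the fundamental loops on all large even tori
caps `s ≤ −log(wβ) = (1 + log(r_ρ/β)) + κ₀` (RP + plaquette floor), and the rate-tracking strong-coupling cold pressure at rate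
`(1 + log(r_ρ/β))/8 ≥ c√s` (input (a)) is the asserted `ColdPressureBound` on every odd torus. -/
theorem ratioStrongCouplingRP_holds : RatioStrongCouplingRP := by
  intro G _ _ _ _ hG hsc
  letI : MeasurableSpace G := borel G
  haveI : BorelSpace G := ⟨rfl⟩
  intro r hSU hN2
  haveI : SecondCountableTopology G :=
    (r.continuous.isClosedEmbedding r.injective).isEmbedding.secondCountableTopology
  obtain ⟨β₂, cpl, hβ₂, hcpl, hpl⟩ := exists_plaquette_ge_linear r.ρ hSU hN2
  have hR0 := strongCouplingRadius_pos r.ρ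
  -- the β-independent constants
  obtain ⟨w, hw⟩ : ∃ w : ℝ, w = min cpl 1 := ⟨_, rfl⟩
  have hw0 : 0 < w := by rw [hw]; exact lt_min hcpl one_pos
  have hwc : w ≤ cpl := by rw [hw]; exact min_le_left _ _
  obtain ⟨κ₀, hκ₀⟩ : ∃ κ₀ : ℝ, κ₀ = -Real.log (w * strongCouplingRadius r.ρ) - 1 := ⟨_, rfl⟩
  refine ⟨1 / (8 * Real.sqrt (1 + max κ₀ 0)), ?_, min β₂ (strongCouplingRadius r.ρ), lt_min hβ₂ hR0,
    fun β hβ0 hββD s hs C hAL => ?_⟩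
  · have : 0 < 1 + max κ₀ 0 := by have := le_max_right κ₀ 0; linarith
    positivity
  have hβ2 : β ≤ β₂ := hββD.trans (min_le_left _ _)
  have hβR : β ≤ strongCouplingRadius r.ρ := hββD.trans (min_le_right _ _)
  obtain ⟨L₂, hL₂⟩ := hAL
  -- (i) the rate cap `s ≤ -log (w β)` at the same `β`
  have hwβ0 : 0 < w * β := mul_pos hw0 hβ0
  have hcap : s ≤ -Real.log (w * β) := by
    refine rate_le_neg_log_of_areaLaw hwβ0 (D := |C| + 1) (by linarith [abs_nonneg C]) (n₀ := max L₂ 2) fun n hn => ?_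
    have hn2 : 2 ≤ n := le_trans (le_max_right _ _) hn
    have hnL : L₂ ≤ 2 * n := le_trans (le_max_left _ _) (le_trans hn (by omega))
    haveI : NeZero (2 * n) := ⟨by omega⟩
    have hE : Even (2 * n) := even_two_mul n
    have hS := plaquette_pow_le_wilsonExpectation_wilsonLoopRep (d := 4) (L := 2 * n) r.ρ r.ρ (by norm_num) hE r.continuous
      hβ0.le r.continuous (show r.N ≠ 0 by omega) (h := n) (R := n) (by omega) (by omega)
    have hP := hpl β hβ0 hβ2 (2 * n) (by omega)
    have hwP : w * β ≤ wilsonExpectation r.ρ β (wilsonLoop r.ρ (0 : Site 4 (2 * n)) 0 1 1 1) :=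
      le_trans (mul_le_mul_of_nonneg_right hwc hβ0.le) hP
    have hA := hL₂ (2 * n) hnL hE n n (by omega) (by omega) le_rfl le_rfl
    calc (w * β) ^ (n * n) ≤ wilsonExpectation r.ρ β (wilsonLoop r.ρ (0 : Site 4 (2 * n)) 0 1 1 1) ^ (n * n) :=
          pow_le_pow_left₀ hwβ0.le hwP _
      _ ≤ wilsonExpectation r.ρ β (wilsonLoop r.ρ (0 : Site 4 (2 * n)) 0 1 n n) := hS
      _ ≤ |wilsonExpectation r.ρ β (wilsonLoop r.ρ (0 : Site 4 (2 * n)) 0 1 n n)| := le_abs_self _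
      _ ≤ C ^ (2 * (n + n)) * Real.exp (-(s * n * n)) := hA
      _ ≤ (|C| + 1) ^ (2 * (n + n)) * Real.exp (-(s * n * n)) := by
          refine mul_le_mul_of_nonneg_right ?_ (Real.exp_pos _).le
          calc C ^ (2 * (n + n)) ≤ |C ^ (2 * (n + n))| := le_abs_self _
            _ = |C| ^ (2 * (n + n)) := abs_pow _ _
            _ ≤ (|C| + 1) ^ (2 * (n + n)) := pow_le_pow_left₀ (abs_nonneg _) (by linarith) _
  -- (ii) input (a): cold pressure at rate `τ/8`, `τ = 1 + log(r_ρ/β)`, on every torus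
  obtain ⟨τ, hτdef⟩ : ∃ τ : ℝ, τ = 1 + Real.log (strongCouplingRadius r.ρ / β) := ⟨_, rfl⟩
  have hq : 1 ≤ strongCouplingRadius r.ρ / β := by rw [le_div_iff₀ hβ0, one_mul]; exact hβR
  have hτ : 1 ≤ τ := by have := Real.log_nonneg hq; rw [hτdef]; linarith
  have hcp : ∀ S : ℕ, ColdPressureBound r.ρ β S (τ / 8) (28311552 * Real.exp 28311552) := fun S => by
    rw [hτdef]; exact coldPressureBound_strongCoupling_log r hβ0 hβR S
  -- (iii) `-log (w β) = τ + κ₀`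
  have hℓ : -Real.log (w * β) = τ + κ₀ := by
    rw [hτdef, hκ₀, Real.log_mul hw0.ne' hβ0.ne', Real.log_mul hw0.ne' hR0.ne', Real.log_div hR0.ne' hβ0.ne']
    ring
  refine ⟨28311552 * Real.exp 28311552, by positivity, 0, fun S _ => coldPressureBound_mono_rate (hcp S) (by positivity) ?_⟩
  exact sqrt_rate_le_of_log hτ hℓ hcap

end Summit.QuantumFields.YangMills.Cruxes.IR.TensionRatio

end
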